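import Summits.ResolutionOfSingularities.ResolutionOfSingularities.Theorems.PurelyInseparableDim4ChartAtlasFarMemberDictionary
import HarnessLib

/-!
# Purely inseparable four-folds `z^p + F(x₁, …, x₄)`: the dictionary for TRANSLATED-QUADRIC (TQ) boundary members
# `((y_k + β)·y_j − c′·y_k + e)·𝒪` under ANY later blow-up along `V(y_0, y_{S′})`, on EVERY chart (cell `res-dim4-pi`, typ-2 g8; S3-N2 support)

[OURS · counted 0] (D-0157 DOOR 2; DR-157-C; desk WORD #238/#241; typ-2 g8 NEXT-BRICK (α).) After the far repair at several heights an inactive far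
quadric reads `TQ_{k,j}(β, c′, e) = ((y_k + β)·y_j − c′·y_k + e)·𝒪` with `c′ ≠ 0` (p723327 `strictTransform_farQuadric_inactive_height`, p725596
clause (9)); such members are INPUT boundary of every later step (typ-3's tranche 3). This file reads them through the NEXT blow-up `π′` of `𝔸⁵`
along `V(y_0, y_{S′})` on the chart `y_t`, `t ∈ S′`, by p696894's engine (`ψ_t f = y_t^0 · g`, `y_t ∤ g`). PROVED here (no `sorry`, no new axiom):

* §1 algebra: `coordBlowupSubst_X_succ_eq_ite` (`ψ_t(y_m) = y_t·y_m` iff `m ∈ S′ ∖ {t}`), `coordBlowupSubst_tquadric` (the substituted member,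
  all cases at once), `constantCoeff_tquadric` (`= e`), `tquadric_swap` (`TQ_{k,j}(β, c′, e) = TQ_{j,k}(−c′, −β, e)`: the shape is symmetric);
* §2 `e ≠ 0` (the member misses the walk's point): **`strictTransformIdeal_tquadric_comap_chartImm_of_ne_zero`** — the strict transform is the
  total transform on every chart (all cases in one `if`-statement), with the clean corollaries: `k ∉ S′ ∌ j` unchanged; `j ∈ S′ ∌ k`, chart `t ≠ j`:
  the CUBIC `(y_k + β)·y_t·y_j − c′·y_k + e`; `k ∈ S′ ∌ j`: chart `k` unchanged, chart `t ≠ k` the cubic `(y_t y_k + β)·y_j − c′·y_t y_k + e`;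
  `k, j ∈ S′`: chart `k` `(y_k + β)·y_k y_j − c′·y_k + e`, chart `t ∉ {j, k}` the QUARTIC `(y_t y_k + β)·y_t y_j − c′·y_t y_k + e`
  (chart `j` is p707037's `comap_chartImm_strictTransform_nonresonant_after_farRepair` shape `(y_j y_k + β)·y_j − c′·y_j y_k + e` for the
  frame `S′ = insert j T`, stated here for a general `S′` as `…_mem_mem_chart_j`);
* §3 ANY `e` (also `e = 0`: the member passes through the walk's point) when a degree-one monomial survives: `k ∉ S′`, `c′ ≠ 0` (witness `y_k`):
  unchanged on the charts `t` with `j ∉ S′ ∖ {t}` (`…_of_not_mem`), cubic on the charts `t ≠ j` when `j ∈ S′` (`…_of_not_mem_cubic`); by the swap,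
  `j ∉ S′`, `β ≠ 0` (witness `y_j`): `…_of_not_mem_right`, `…_of_not_mem_right_cubic`.

* §4 (appended) `e = 0`, `c′ ≠ 0` with BOTH `k, j ∈ S′` (the member passes through the walk's point and `y_t ∣ ψ_t` it exactly once): chart `y_j` ↦
  `TQ_{k,j}(0, c′, β) = (y_k·y_j − c′·y_k + β)` (`…_mem_mem_chart_j_of_eq_zero`; stays in the alphabet), chart `y_k` ↦ the FAR QUADRIC `(y_k + β)·y_j − c′`
  (`…_mem_mem_chart_k_of_eq_zero`), chart `t ∉ {j, k}` ↦ the cubic `(y_t y_k + β)·y_j − c′·y_k` THROUGH the point (`…_mem_mem_of_eq_zero`); and `k ∈ S′ ∌ j`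
  with `β = e = 0` (the reducible member `y_k·(y_j − c′)`): chart `y_k` ↦ the translated hyperplane `y_j − c′` (`…_mem_not_mem_chart_k_of_eq_zero`), chart
  `t ≠ k` ↦ unchanged (`…_mem_not_mem_of_eq_zero`). With §2–§4 every TQ member with `c′ ≠ 0` is read on every chart of every later coordinate blow-up.
The TQ alphabet, like the far alphabet (p705352), is NOT closed under the walk (cubics / quartics appear as soon as an index enters a later centre).

Nothing here is a statement about resolution of singularities in dimension ≥ 4 / characteristic `p` (NOT proved anywhere in this programme).
bears_on: LADDER-RESOLUTION:D157-DOOR2 (res-dim4-pi). Supports stmt-ResolutionOfSingularities-16155 (helper, S3-N2 dictionary).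
-/

-- every declaration of this summit lives under `Summit.ResolutionOfSingularities.ResolutionOfSingularities`
-- (summit = problem), which the duplicate-namespace linter flags; house convention (cf. the Target file).
set_option linter.dupNamespace false

noncomputable section

open MvPolynomial CategoryTheory AlgebraicGeometry Opposite TopologicalSpace
open AlgebraicGeometry.Scheme.IdealSheafData (ofIdealTop)

namespace Summit.ResolutionOfSingularities.ResolutionOfSingularities.Theorems.PIDim4

open Literature.AlgebraicGeometry.Resolution
open Literature.AlgebraicGeometry.Resolution.AffinePointBlowup (P A γ coord Wtop ξ)

namespace ChartDictionary

variable {K : Type} [Field K] {S' : Finset (Fin 4)} {t k j : Fin 4} {W : Scheme.{0}} {π' : W ⟶ P 4 K}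

/-! ## §1 The chart substitution on a TQ member -/

/-- `ψ_t(y_m) = y_t·y_m` when `m ∈ S′ ∖ {t}`, and `ψ_t(y_m) = y_m` otherwise. -/
theorem coordBlowupSubst_X_succ_eq_ite (m : Fin 4) :
    coordBlowupSubst K (insert 0 (Fin.succ '' (S' : Set (Fin 4)))) t.succ (X m.succ : A 4 K) =
      if m ∈ S' ∧ m ≠ t then X t.succ * X m.succ else X m.succ := by
  classical
  by_cases hm : m ∈ S' ∧ m ≠ t
  · rw [if_pos hm]
    exact coordBlowupSubst_X_of_mem_of_ne K _ t.succ (succ_mem_centreVars hm.1) (fun e => hm.2 (Fin.succ_injective _ e))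
  · rw [if_neg hm]
    by_cases hmt : m = t
    · subst hmt
      rw [coordBlowupSubst_X_self]
    · exact coordBlowupSubst_X_of_not_mem K _ t.succ (fun h => hm ⟨(succ_mem_centreVars_iff S' m).mp h, hmt⟩)

/-- **The substituted TQ member, all cases at once**: `ψ_t(((y_k + β)·y_j − c′·y_k + e)) = (ψ_t(y_k) + β)·ψ_t(y_j) − c′·ψ_t(y_k) + e`. -/
theorem coordBlowupSubst_tquadric (β c' e : K) :
    coordBlowupSubst K (insert 0 (Fin.succ '' (S' : Set (Fin 4)))) t.succ ((X k.succ + C β) * X j.succ - C c' * X k.succ + C e : A 4 K) =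
      ((if k ∈ S' ∧ k ≠ t then X t.succ * X k.succ else X k.succ) + C β) * (if j ∈ S' ∧ j ≠ t then X t.succ * X j.succ else X j.succ)
        - C c' * (if k ∈ S' ∧ k ≠ t then X t.succ * X k.succ else X k.succ) + C e := by
  simp only [map_add, map_sub, map_mul, coordBlowupSubst_C, coordBlowupSubst_X_succ_eq_ite]

/-- The constant term of a TQ member is `e`. -/
theorem constantCoeff_tquadric (β c' e : K) : constantCoeff ((X k.succ + C β) * X j.succ - C c' * X k.succ + C e : A 4 K) = e := by
  simp only [map_add, map_sub, map_mul, constantCoeff_X, constantCoeff_C, mul_zero, sub_zero, zero_add]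

/-- **The TQ shape is symmetric in its two variables**: `(y_k + β)·y_j − c′·y_k + e = (y_j − c′)·y_k + β·y_j + e = TQ_{j,k}(−c′, −β, e)`. -/
theorem tquadric_swap (β c' e : K) :
    ((X k.succ + C β) * X j.succ - C c' * X k.succ + C e : A 4 K) = (X j.succ + C (-c')) * X k.succ - C (-β) * X j.succ + C e := by
  simp only [map_neg]
  ring

/-! ## §2 `e ≠ 0`: the member misses the walk's point — total transform on every chart -/

/-- **THE TQ DICTIONARY, `e ≠ 0`.** For ANY blowing up `π′ : W → 𝔸⁵` along `V(y_0, y_{S′})`, `t ∈ S′`: the strict transform of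
`((y_k + β)·y_j − c′·y_k + e)·𝒪` with `e ≠ 0` reads `((ψ_t y_k + β)·ψ_t y_j − c′·ψ_t y_k + e)·𝒪` on the chart `y_t` (`ψ_t y_m = y_t y_m` iff
`m ∈ S′ ∖ {t}`). -/
theorem strictTransformIdeal_tquadric_comap_chartImm_of_ne_zero (ht : t ∈ S') (β c' : K) {e : K} (he : e ≠ 0)
    (hπ' : IsBlowup π' (AffineCoordBlowup.𝓘Λ 4 K (insert 0 (Fin.succ '' (S' : Set (Fin 4)))))) :
    (strictTransformIdeal π' (AffineCoordBlowup.𝓘Λ 4 K (insert 0 (Fin.succ '' (S' : Set (Fin 4)))))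
        (ofIdealTop (Ideal.span {(γ 4 K).symm ((X k.succ + C β) * X j.succ - C c' * X k.succ + C e)}))).comap
        (AffineCoordBlowup.chartImm hπ' (succ_mem_centreVars ht)) =
      ofIdealTop (Ideal.span {(γ 4 K).symm
        (((if k ∈ S' ∧ k ≠ t then X t.succ * X k.succ else X k.succ) + C β) * (if j ∈ S' ∧ j ≠ t then X t.succ * X j.succ else X j.succ)
          - C c' * (if k ∈ S' ∧ k ≠ t then X t.succ * X k.succ else X k.succ) + C e)}) := by
  rw [strictTransformIdeal_comap_chartImm_of_constantCoeff_ne_zero ht (by rw [constantCoeff_tquadric]; exact he) hπ', coordBlowupSubst_tquadric]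

/-- `e ≠ 0`, `k ∉ S′ ∌ j`: the member is UNCHANGED on every chart `y_t`, `t ∈ S′`. -/
theorem strictTransformIdeal_tquadric_comap_chartImm_not_mem_not_mem (ht : t ∈ S') (hk : k ∉ S') (hj : j ∉ S') (β c' : K) {e : K}
    (he : e ≠ 0) (hπ' : IsBlowup π' (AffineCoordBlowup.𝓘Λ 4 K (insert 0 (Fin.succ '' (S' : Set (Fin 4)))))) :
    (strictTransformIdeal π' (AffineCoordBlowup.𝓘Λ 4 K (insert 0 (Fin.succ '' (S' : Set (Fin 4)))))
        (ofIdealTop (Ideal.span {(γ 4 K).symm ((X k.succ + C β) * X j.succ - C c' * X k.succ + C e)}))).comap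
        (AffineCoordBlowup.chartImm hπ' (succ_mem_centreVars ht)) =
      ofIdealTop (Ideal.span {(γ 4 K).symm ((X k.succ + C β) * X j.succ - C c' * X k.succ + C e)}) := by
  rw [strictTransformIdeal_tquadric_comap_chartImm_of_ne_zero ht β c' he hπ', if_neg (fun h => hk h.1), if_neg (fun h => hj h.1)]

/-- `e ≠ 0`, `j ∈ S′ ∌ k`, chart `y_t`, `t ≠ j`: the member becomes the CUBIC `((y_k + β)·y_t y_j − c′·y_k + e)·𝒪`. (On the chart `y_j` it
is unchanged: p707037 / p708880 `comap_chartImm_strictTransform_tquadric_of_not_mem_after_farRepair(')` for `S′ = insert j T`; §3 below.) -/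
theorem strictTransformIdeal_tquadric_comap_chartImm_not_mem_mem (ht : t ∈ S') (hk : k ∉ S') (hj : j ∈ S') (hjt : j ≠ t) (β c' : K)
    {e : K} (he : e ≠ 0) (hπ' : IsBlowup π' (AffineCoordBlowup.𝓘Λ 4 K (insert 0 (Fin.succ '' (S' : Set (Fin 4)))))) :
    (strictTransformIdeal π' (AffineCoordBlowup.𝓘Λ 4 K (insert 0 (Fin.succ '' (S' : Set (Fin 4)))))
        (ofIdealTop (Ideal.span {(γ 4 K).symm ((X k.succ + C β) * X j.succ - C c' * X k.succ + C e)}))).comap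
        (AffineCoordBlowup.chartImm hπ' (succ_mem_centreVars ht)) =
      ofIdealTop (Ideal.span {(γ 4 K).symm ((X k.succ + C β) * (X t.succ * X j.succ) - C c' * X k.succ + C e)}) := by
  rw [strictTransformIdeal_tquadric_comap_chartImm_of_ne_zero ht β c' he hπ', if_neg (fun h => hk h.1), if_pos (And.intro hj hjt)]

/-- `e ≠ 0`, `k ∈ S′ ∌ j`, chart `y_k`: the member is UNCHANGED. -/
theorem strictTransformIdeal_tquadric_comap_chartImm_mem_not_mem_chart_k (hk : k ∈ S') (hj : j ∉ S') (β c' : K) {e : K} (he : e ≠ 0)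
    (hπ' : IsBlowup π' (AffineCoordBlowup.𝓘Λ 4 K (insert 0 (Fin.succ '' (S' : Set (Fin 4)))))) :
    (strictTransformIdeal π' (AffineCoordBlowup.𝓘Λ 4 K (insert 0 (Fin.succ '' (S' : Set (Fin 4)))))
        (ofIdealTop (Ideal.span {(γ 4 K).symm ((X k.succ + C β) * X j.succ - C c' * X k.succ + C e)}))).comap
        (AffineCoordBlowup.chartImm hπ' (succ_mem_centreVars hk)) =
      ofIdealTop (Ideal.span {(γ 4 K).symm ((X k.succ + C β) * X j.succ - C c' * X k.succ + C e)}) := by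
  rw [strictTransformIdeal_tquadric_comap_chartImm_of_ne_zero hk β c' he hπ', if_neg (fun h => h.2 rfl), if_neg (fun h => hj h.1)]

/-- `e ≠ 0`, `k ∈ S′ ∌ j`, chart `y_t`, `t ≠ k`: the member becomes the CUBIC `((y_t y_k + β)·y_j − c′·y_t y_k + e)·𝒪`. -/
theorem strictTransformIdeal_tquadric_comap_chartImm_mem_not_mem (ht : t ∈ S') (hk : k ∈ S') (hkt : k ≠ t) (hj : j ∉ S') (β c' : K)
    {e : K} (he : e ≠ 0) (hπ' : IsBlowup π' (AffineCoordBlowup.𝓘Λ 4 K (insert 0 (Fin.succ '' (S' : Set (Fin 4)))))) :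
    (strictTransformIdeal π' (AffineCoordBlowup.𝓘Λ 4 K (insert 0 (Fin.succ '' (S' : Set (Fin 4)))))
        (ofIdealTop (Ideal.span {(γ 4 K).symm ((X k.succ + C β) * X j.succ - C c' * X k.succ + C e)}))).comap
        (AffineCoordBlowup.chartImm hπ' (succ_mem_centreVars ht)) =
      ofIdealTop (Ideal.span {(γ 4 K).symm ((X t.succ * X k.succ + C β) * X j.succ - C c' * (X t.succ * X k.succ) + C e)}) := by
  rw [strictTransformIdeal_tquadric_comap_chartImm_of_ne_zero ht β c' he hπ', if_pos (And.intro hk hkt), if_neg (fun h => hj h.1)]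

/-- `e ≠ 0`, `k, j ∈ S′`, chart `y_j`: the member reads `((y_j y_k + β)·y_j − c′·y_j y_k + e)·𝒪` (p707037's chart-`j` shape, general `S′`). -/
theorem strictTransformIdeal_tquadric_comap_chartImm_mem_mem_chart_j (hk : k ∈ S') (hj : j ∈ S') (hkj : k ≠ j) (β c' : K) {e : K}
    (he : e ≠ 0) (hπ' : IsBlowup π' (AffineCoordBlowup.𝓘Λ 4 K (insert 0 (Fin.succ '' (S' : Set (Fin 4)))))) :
    (strictTransformIdeal π' (AffineCoordBlowup.𝓘Λ 4 K (insert 0 (Fin.succ '' (S' : Set (Fin 4)))))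
        (ofIdealTop (Ideal.span {(γ 4 K).symm ((X k.succ + C β) * X j.succ - C c' * X k.succ + C e)}))).comap
        (AffineCoordBlowup.chartImm hπ' (succ_mem_centreVars hj)) =
      ofIdealTop (Ideal.span {(γ 4 K).symm ((X j.succ * X k.succ + C β) * X j.succ - C c' * (X j.succ * X k.succ) + C e)}) := by
  rw [strictTransformIdeal_tquadric_comap_chartImm_of_ne_zero hj β c' he hπ', if_pos (And.intro hk hkj), if_neg (fun h => h.2 rfl)]

/-- `e ≠ 0`, `k, j ∈ S′`, chart `y_k`: the member reads the cubic `((y_k + β)·y_k y_j − c′·y_k + e)·𝒪`. -/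
theorem strictTransformIdeal_tquadric_comap_chartImm_mem_mem_chart_k (hk : k ∈ S') (hj : j ∈ S') (hjk : j ≠ k) (β c' : K) {e : K}
    (he : e ≠ 0) (hπ' : IsBlowup π' (AffineCoordBlowup.𝓘Λ 4 K (insert 0 (Fin.succ '' (S' : Set (Fin 4)))))) :
    (strictTransformIdeal π' (AffineCoordBlowup.𝓘Λ 4 K (insert 0 (Fin.succ '' (S' : Set (Fin 4)))))
        (ofIdealTop (Ideal.span {(γ 4 K).symm ((X k.succ + C β) * X j.succ - C c' * X k.succ + C e)}))).comap
        (AffineCoordBlowup.chartImm hπ' (succ_mem_centreVars hk)) =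
      ofIdealTop (Ideal.span {(γ 4 K).symm ((X k.succ + C β) * (X k.succ * X j.succ) - C c' * X k.succ + C e)}) := by
  rw [strictTransformIdeal_tquadric_comap_chartImm_of_ne_zero hk β c' he hπ', if_neg (fun h => h.2 rfl), if_pos (And.intro hj hjk)]

/-- `e ≠ 0`, `k, j ∈ S′`, chart `y_t`, `t ∉ {j, k}`: the member becomes the QUARTIC `((y_t y_k + β)·y_t y_j − c′·y_t y_k + e)·𝒪`. -/
theorem strictTransformIdeal_tquadric_comap_chartImm_mem_mem (ht : t ∈ S') (hk : k ∈ S') (hkt : k ≠ t) (hj : j ∈ S') (hjt : j ≠ t)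
    (β c' : K) {e : K} (he : e ≠ 0) (hπ' : IsBlowup π' (AffineCoordBlowup.𝓘Λ 4 K (insert 0 (Fin.succ '' (S' : Set (Fin 4)))))) :
    (strictTransformIdeal π' (AffineCoordBlowup.𝓘Λ 4 K (insert 0 (Fin.succ '' (S' : Set (Fin 4)))))
        (ofIdealTop (Ideal.span {(γ 4 K).symm ((X k.succ + C β) * X j.succ - C c' * X k.succ + C e)}))).comap
        (AffineCoordBlowup.chartImm hπ' (succ_mem_centreVars ht)) =
      ofIdealTop (Ideal.span {(γ 4 K).symm
        ((X t.succ * X k.succ + C β) * (X t.succ * X j.succ) - C c' * (X t.succ * X k.succ) + C e)}) := by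
  rw [strictTransformIdeal_tquadric_comap_chartImm_of_ne_zero ht β c' he hπ', if_pos (And.intro hk hkt), if_pos (And.intro hj hjt)]

/-! ## §3 Any `e` (the member may pass through the walk's point): a surviving degree-one monomial -/

/-- `y_t ∤ M·y_j − c′·y_k + e` for `t ≠ k ≠ j`, `c′ ≠ 0`, ANY `M` and `e`: the monomial `y_k` has coefficient `−c′`. -/
theorem not_coord_dvd_γ_symm_tquadric_like (htk : t ≠ k) (hkj : k ≠ j) (M : A 4 K) {c' : K} (hc : c' ≠ 0) (e : K) :
    ¬ coord 4 K t.succ ∣ (γ 4 K).symm (M * X j.succ - C c' * X k.succ + C e) := by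
  classical
  have hkj' : (k.succ : Fin (4 + 1)) ≠ j.succ := fun h => hkj (Fin.succ_injective _ h)
  have htk' : (t.succ : Fin (4 + 1)) ≠ k.succ := fun h => htk (Fin.succ_injective _ h)
  refine not_coord_dvd_γ_symm_of_coeff (Finsupp.single k.succ 1) (Finsupp.single_eq_of_ne htk') ?_
  have hne : (0 : Fin (4 + 1) →₀ ℕ) ≠ Finsupp.single k.succ 1 := (Finsupp.single_ne_zero.mpr one_ne_zero).symm
  rw [coeff_add, coeff_sub, coeff_mul_X', if_neg (by rw [Finsupp.mem_support_iff, not_not]; exact Finsupp.single_eq_of_ne hkj'.symm),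
    coeff_C_mul, coeff_X, if_pos rfl, coeff_C, if_neg hne, zero_sub, add_zero, mul_one, neg_ne_zero]
  exact hc

/-- **`k ∉ S′`, `c′ ≠ 0`, ANY `e`, chart `y_t` with `j ∉ S′ ∖ {t}` (i.e. `j ∉ S′`, or `t = j`): the member is UNCHANGED** — also when `e = 0`
(the member passes through the walk's point; `y_t ∤` it because of the monomial `−c′·y_k`). -/
theorem strictTransformIdeal_tquadric_comap_chartImm_of_not_mem (ht : t ∈ S') (hk : k ∉ S') (hkj : k ≠ j) (hjt : ¬ (j ∈ S' ∧ j ≠ t))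
    (β : K) {c' : K} (hc : c' ≠ 0) (e : K) (hπ' : IsBlowup π' (AffineCoordBlowup.𝓘Λ 4 K (insert 0 (Fin.succ '' (S' : Set (Fin 4)))))) :
    (strictTransformIdeal π' (AffineCoordBlowup.𝓘Λ 4 K (insert 0 (Fin.succ '' (S' : Set (Fin 4)))))
        (ofIdealTop (Ideal.span {(γ 4 K).symm ((X k.succ + C β) * X j.succ - C c' * X k.succ + C e)}))).comap
        (AffineCoordBlowup.chartImm hπ' (succ_mem_centreVars ht)) =
      ofIdealTop (Ideal.span {(γ 4 K).symm ((X k.succ + C β) * X j.succ - C c' * X k.succ + C e)}) := by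
  have htk : t ≠ k := fun h => hk (h ▸ ht)
  refine strictTransformIdeal_principal_comap_chartImm ht 0 ?_ (not_coord_dvd_γ_symm_tquadric_like htk hkj _ hc e) hπ'
  rw [pow_zero, one_mul, coordBlowupSubst_tquadric, if_neg (fun h => hk h.1), if_neg hjt]

/-- **`k ∉ S′ ∋ j`, `c′ ≠ 0`, ANY `e`, chart `y_t`, `t ≠ j`: the member becomes the CUBIC `((y_k + β)·y_t y_j − c′·y_k + e)·𝒪`** — also when
`e = 0`. -/
theorem strictTransformIdeal_tquadric_comap_chartImm_of_not_mem_cubic (ht : t ∈ S') (hk : k ∉ S') (hkj : k ≠ j) (hj : j ∈ S') (hjt : j ≠ t)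
    (β : K) {c' : K} (hc : c' ≠ 0) (e : K) (hπ' : IsBlowup π' (AffineCoordBlowup.𝓘Λ 4 K (insert 0 (Fin.succ '' (S' : Set (Fin 4)))))) :
    (strictTransformIdeal π' (AffineCoordBlowup.𝓘Λ 4 K (insert 0 (Fin.succ '' (S' : Set (Fin 4)))))
        (ofIdealTop (Ideal.span {(γ 4 K).symm ((X k.succ + C β) * X j.succ - C c' * X k.succ + C e)}))).comap
        (AffineCoordBlowup.chartImm hπ' (succ_mem_centreVars ht)) =
      ofIdealTop (Ideal.span {(γ 4 K).symm ((X k.succ + C β) * (X t.succ * X j.succ) - C c' * X k.succ + C e)}) := by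
  have htk : t ≠ k := fun h => hk (h ▸ ht)
  refine strictTransformIdeal_principal_comap_chartImm ht 0 ?_ ?_ hπ'
  · rw [pow_zero, one_mul, coordBlowupSubst_tquadric, if_neg (fun h => hk h.1), if_pos (And.intro hj hjt)]
  · rw [← mul_assoc]
    exact not_coord_dvd_γ_symm_tquadric_like htk hkj _ hc e

/-- **`j ∉ S′`, `β ≠ 0`, ANY `c′, e`, chart `y_t` with `k ∉ S′ ∖ {t}`: the member is UNCHANGED** (by the swap: witness monomial `β·y_j`). -/
theorem strictTransformIdeal_tquadric_comap_chartImm_of_not_mem_right (ht : t ∈ S') (hj : j ∉ S') (hkj : k ≠ j) (hkt : ¬ (k ∈ S' ∧ k ≠ t))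
    {β : K} (hβ : β ≠ 0) (c' e : K) (hπ' : IsBlowup π' (AffineCoordBlowup.𝓘Λ 4 K (insert 0 (Fin.succ '' (S' : Set (Fin 4)))))) :
    (strictTransformIdeal π' (AffineCoordBlowup.𝓘Λ 4 K (insert 0 (Fin.succ '' (S' : Set (Fin 4)))))
        (ofIdealTop (Ideal.span {(γ 4 K).symm ((X k.succ + C β) * X j.succ - C c' * X k.succ + C e)}))).comap
        (AffineCoordBlowup.chartImm hπ' (succ_mem_centreVars ht)) =
      ofIdealTop (Ideal.span {(γ 4 K).symm ((X k.succ + C β) * X j.succ - C c' * X k.succ + C e)}) := by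
  rw [tquadric_swap β c' e]
  exact strictTransformIdeal_tquadric_comap_chartImm_of_not_mem ht hj (Ne.symm hkj) hkt (-c') (neg_ne_zero.mpr hβ) e hπ'

/-- **`j ∉ S′ ∋ k`, `β ≠ 0`, ANY `c′, e`, chart `y_t`, `t ≠ k`: the member becomes the CUBIC `((y_t y_k + β)·y_j − c′·y_t y_k + e)·𝒪`.** -/
theorem strictTransformIdeal_tquadric_comap_chartImm_of_not_mem_right_cubic (ht : t ∈ S') (hj : j ∉ S') (hkj : k ≠ j) (hk : k ∈ S')
    (hkt : k ≠ t) {β : K} (hβ : β ≠ 0) (c' e : K)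
    (hπ' : IsBlowup π' (AffineCoordBlowup.𝓘Λ 4 K (insert 0 (Fin.succ '' (S' : Set (Fin 4)))))) :
    (strictTransformIdeal π' (AffineCoordBlowup.𝓘Λ 4 K (insert 0 (Fin.succ '' (S' : Set (Fin 4)))))
        (ofIdealTop (Ideal.span {(γ 4 K).symm ((X k.succ + C β) * X j.succ - C c' * X k.succ + C e)}))).comap
        (AffineCoordBlowup.chartImm hπ' (succ_mem_centreVars ht)) =
      ofIdealTop (Ideal.span {(γ 4 K).symm ((X t.succ * X k.succ + C β) * X j.succ - C c' * (X t.succ * X k.succ) + C e)}) := by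
  have hP : ((X j.succ + C (-c')) * (X t.succ * X k.succ) - C (-β) * X j.succ + C e : A 4 K) =
      (X t.succ * X k.succ + C β) * X j.succ - C c' * (X t.succ * X k.succ) + C e := by
    simp only [map_neg]
    ring
  rw [tquadric_swap β c' e, ← hP]
  exact strictTransformIdeal_tquadric_comap_chartImm_of_not_mem_cubic ht hj (Ne.symm hkj) hk hkt (-c') (neg_ne_zero.mpr hβ) e hπ'

/-! ## §4 `e = 0`, `c′ ≠ 0`, an index in the centre: `y_t` divides once -/

/-- **`k, j ∈ S′`, `e = 0`, chart `y_j`: the member reads `TQ_{k,j}(0, c′, β) = (y_k·y_j − c′·y_k + β)·𝒪`** (`ψ_j` of it is `y_j` times that; `y_j ∤`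
the quotient because of `−c′·y_k`). The reading STAYS in the TQ alphabet. -/
theorem strictTransformIdeal_tquadric_comap_chartImm_mem_mem_chart_j_of_eq_zero (hk : k ∈ S') (hj : j ∈ S') (hkj : k ≠ j) (β : K) {c' e : K}
    (hc : c' ≠ 0) (he : e = 0) (hπ' : IsBlowup π' (AffineCoordBlowup.𝓘Λ 4 K (insert 0 (Fin.succ '' (S' : Set (Fin 4)))))) :
    (strictTransformIdeal π' (AffineCoordBlowup.𝓘Λ 4 K (insert 0 (Fin.succ '' (S' : Set (Fin 4)))))
        (ofIdealTop (Ideal.span {(γ 4 K).symm ((X k.succ + C β) * X j.succ - C c' * X k.succ + C e)}))).comap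
        (AffineCoordBlowup.chartImm hπ' (succ_mem_centreVars hj)) =
      ofIdealTop (Ideal.span {(γ 4 K).symm ((X k.succ + C 0) * X j.succ - C c' * X k.succ + C β)}) := by
  subst he
  refine strictTransformIdeal_principal_comap_chartImm hj 1 ?_ (not_coord_dvd_γ_symm_tquadric_like (Ne.symm hkj) hkj _ hc β) hπ'
  rw [coordBlowupSubst_tquadric, if_pos (And.intro hk hkj), if_neg (fun h => h.2 rfl), C_0]
  ring

/-- **`k, j ∈ S′`, `e = 0`, chart `y_k`: the member reads the FAR QUADRIC `((y_k + β)·y_j − c′)·𝒪`** (written `TQ_{k,j}(β, 0, −c′)`; `y_k ∤` it: constant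
term `−c′`). -/
theorem strictTransformIdeal_tquadric_comap_chartImm_mem_mem_chart_k_of_eq_zero (hk : k ∈ S') (hj : j ∈ S') (hjk : j ≠ k) (β : K) {c' e : K}
    (hc : c' ≠ 0) (he : e = 0) (hπ' : IsBlowup π' (AffineCoordBlowup.𝓘Λ 4 K (insert 0 (Fin.succ '' (S' : Set (Fin 4)))))) :
    (strictTransformIdeal π' (AffineCoordBlowup.𝓘Λ 4 K (insert 0 (Fin.succ '' (S' : Set (Fin 4)))))
        (ofIdealTop (Ideal.span {(γ 4 K).symm ((X k.succ + C β) * X j.succ - C c' * X k.succ + C e)}))).comap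
        (AffineCoordBlowup.chartImm hπ' (succ_mem_centreVars hk)) =
      ofIdealTop (Ideal.span {(γ 4 K).symm ((X k.succ + C β) * X j.succ - C 0 * X k.succ + C (-c'))}) := by
  subst he
  refine strictTransformIdeal_principal_comap_chartImm hk 1 ?_ ?_ hπ'
  · rw [coordBlowupSubst_tquadric, if_neg (fun h => h.2 rfl), if_pos (And.intro hj hjk), C_0, map_neg]
    ring
  · refine not_coord_dvd_γ_symm_of_constantCoeff_ne_zero _ ?_
    rw [constantCoeff_tquadric]
    exact neg_ne_zero.mpr hc

/-- **`k, j ∈ S′`, `e = 0`, chart `y_t`, `t ∉ {j, k}`: the member reads the cubic `((y_t y_k + β)·y_j − c′·y_k)·𝒪` THROUGH the walk's point**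
(`ψ_t` of the member is `y_t` times that; `y_t ∤` the quotient because of `−c′·y_k`). -/
theorem strictTransformIdeal_tquadric_comap_chartImm_mem_mem_of_eq_zero (ht : t ∈ S') (hk : k ∈ S') (hkt : k ≠ t) (hj : j ∈ S') (hjt : j ≠ t)
    (hkj : k ≠ j) (β : K) {c' e : K} (hc : c' ≠ 0) (he : e = 0)
    (hπ' : IsBlowup π' (AffineCoordBlowup.𝓘Λ 4 K (insert 0 (Fin.succ '' (S' : Set (Fin 4)))))) :
    (strictTransformIdeal π' (AffineCoordBlowup.𝓘Λ 4 K (insert 0 (Fin.succ '' (S' : Set (Fin 4)))))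
        (ofIdealTop (Ideal.span {(γ 4 K).symm ((X k.succ + C β) * X j.succ - C c' * X k.succ + C e)}))).comap
        (AffineCoordBlowup.chartImm hπ' (succ_mem_centreVars ht)) =
      ofIdealTop (Ideal.span {(γ 4 K).symm ((X t.succ * X k.succ + C β) * X j.succ - C c' * X k.succ)}) := by
  subst he
  refine strictTransformIdeal_principal_comap_chartImm ht 1 ?_ ?_ hπ'
  · rw [coordBlowupSubst_tquadric, if_pos (And.intro hk hkt), if_pos (And.intro hj hjt), C_0]
    ring
  · have h := not_coord_dvd_γ_symm_tquadric_like (Ne.symm hkt) hkj (X t.succ * X k.succ + C β) hc 0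
    rwa [C_0, add_zero] at h

/-- **`k ∈ S′ ∌ j`, `β = e = 0` (the reducible member `y_k·(y_j − c′)·𝒪`), chart `y_k`: it reads the translated hyperplane `(y_j − c′)·𝒪`.** -/
theorem strictTransformIdeal_tquadric_comap_chartImm_mem_not_mem_chart_k_of_eq_zero (hk : k ∈ S') (hj : j ∉ S') {β c' e : K} (hβ : β = 0)
    (hc : c' ≠ 0) (he : e = 0) (hπ' : IsBlowup π' (AffineCoordBlowup.𝓘Λ 4 K (insert 0 (Fin.succ '' (S' : Set (Fin 4)))))) :
    (strictTransformIdeal π' (AffineCoordBlowup.𝓘Λ 4 K (insert 0 (Fin.succ '' (S' : Set (Fin 4)))))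
        (ofIdealTop (Ideal.span {(γ 4 K).symm ((X k.succ + C β) * X j.succ - C c' * X k.succ + C e)}))).comap
        (AffineCoordBlowup.chartImm hπ' (succ_mem_centreVars hk)) =
      ofIdealTop (Ideal.span {(γ 4 K).symm (X j.succ + C (-c'))}) := by
  subst he hβ
  refine strictTransformIdeal_principal_comap_chartImm hk 1 ?_ ?_ hπ'
  · rw [coordBlowupSubst_tquadric, if_neg (fun h => h.2 rfl), if_neg (fun h => hj h.1), C_0, map_neg]
    ring
  · refine not_coord_dvd_γ_symm_of_constantCoeff_ne_zero _ ?_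
    rw [map_add, constantCoeff_X, constantCoeff_C, zero_add]
    exact neg_ne_zero.mpr hc

/-- **`k ∈ S′ ∌ j`, `β = e = 0`, chart `y_t`, `t ≠ k`: the member `y_k·(y_j − c′)·𝒪` is UNCHANGED** (`ψ_t` multiplies it by `y_t` once). -/
theorem strictTransformIdeal_tquadric_comap_chartImm_mem_not_mem_of_eq_zero (ht : t ∈ S') (hk : k ∈ S') (hkt : k ≠ t) (hj : j ∉ S') (hkj : k ≠ j)
    {β c' e : K} (hβ : β = 0) (hc : c' ≠ 0) (he : e = 0)
    (hπ' : IsBlowup π' (AffineCoordBlowup.𝓘Λ 4 K (insert 0 (Fin.succ '' (S' : Set (Fin 4)))))) :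
    (strictTransformIdeal π' (AffineCoordBlowup.𝓘Λ 4 K (insert 0 (Fin.succ '' (S' : Set (Fin 4)))))
        (ofIdealTop (Ideal.span {(γ 4 K).symm ((X k.succ + C β) * X j.succ - C c' * X k.succ + C e)}))).comap
        (AffineCoordBlowup.chartImm hπ' (succ_mem_centreVars ht)) =
      ofIdealTop (Ideal.span {(γ 4 K).symm ((X k.succ + C β) * X j.succ - C c' * X k.succ + C e)}) := by
  subst he hβ
  refine strictTransformIdeal_principal_comap_chartImm ht 1 ?_ (not_coord_dvd_γ_symm_tquadric_like (Ne.symm hkt) hkj _ hc 0) hπ'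
  rw [coordBlowupSubst_tquadric, if_pos (And.intro hk hkt), if_neg (fun h => hj h.1), C_0]
  ring


end ChartDictionary

end Summit.ResolutionOfSingularities.ResolutionOfSingularities.Theorems.PIDim4

end
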